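/-
HONEST FRAMING: certified error envelopes and provably optimal rounding/accumulation schemes for
low-precision formats under stated cost models; every table by two implementations; no hardware
or vendor claims.
-/
import Summits.Ventures.CertifiedArithmetic.LowPrec.OptDemotionRoutingPhi3pOpt

/-!
# The demotion law (Theorem T8), part 10l-0: the node rule for a FOUR-bit configuration, written out

Part 10k-0's general node rule (`injected_le_treeBR_node`, `treeBR_node_le_of_injected`) at
`T = {-a,-b,-e}`, `1 ≤ a < b < e ≤ q-1`, with every injected option shifted to top-normalised
coordinates (opt's four-family recursion, 16 options):
* `treeBR_quad_shift` — homogeneity for four bits;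
* `subset_three_cases` — the eight subsets of `{x,y,z}`;
* `treeBR_quad_node_ge` — the eight `A`-oriented options as LOWER bounds of the node value;
* `treeBR_quad_node_le` — the node value is `1 +` at most any `R ≥ 0` dominating the sixteen
  options;
* `two_treeBR_quad_le` — (MC) at a four-bit configuration in the direction of its lowest bit.
Used by part 10l (the popcount-3 top-level e-side rows E3 for every `q`).
-/

namespace Summit.Ventures.CertifiedArithmetic.LowPrec.Opt

open Literature.ComputerArithmetic.JeannerodRump2018
open Literature.ComputerArithmetic.JeannerodRump2018.SumTree

section QuadNode

variable {q : ℕ}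

/-- Shift of a four-bit configuration: `BR{k, e+k, f+k, g+k} = 2^k BR{0, e, f, g}`. -/
theorem treeBR_quad_shift (t : SumTree) (k e f g : ℤ) :
    treeBR q t {k, e + k, f + k, g + k} = (2 : ℚ) ^ k * treeBR q t {0, e, f, g} := by
  have := treeBR_image_add (q := q) t ({0, e, f, g} : Finset ℤ) k
  rw [Finset.image_insert, Finset.image_insert, image_pair_add, zero_add] at this
  exact this

/-- The subsets of a three-element set. -/
theorem subset_three_cases {x y z : ℤ} {P : Finset ℤ} (h : P ⊆ {x, y, z}) :
    P = ∅ ∨ P = {x} ∨ P = {y} ∨ P = {z} ∨ P = {x, y} ∨ P = {x, z} ∨ P = {y, z} ∨ P = {x, y, z} := by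
  classical
  have h' : P.erase x ⊆ {y, z} := by
    intro w hw
    obtain ⟨hwx, hwP⟩ := Finset.mem_erase.1 hw
    have := h hwP
    simp only [Finset.mem_insert, Finset.mem_singleton] at this ⊢
    rcases this with h1 | h1 | h1
    · exact absurd h1 hwx
    · exact Or.inl h1
    · exact Or.inr h1
  by_cases hx : x ∈ P
  · have hP : P = insert x (P.erase x) := (Finset.insert_erase hx).symm
    rcases subset_two_cases h' with h0 | h0 | h0 | h0 <;> rw [h0] at hP
    · right; left; rw [hP]; rfl
    · right; right; right; right; left; rw [hP]
    · right; right; right; right; right; left; rw [hP]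
    · right; right; right; right; right; right; right; rw [hP]
  · have hP : P = P.erase x := (Finset.erase_eq_of_notMem hx).symm
    rcases subset_two_cases h' with h0 | h0 | h0 | h0 <;> rw [h0] at hP
    · left; exact hP
    · right; right; left; exact hP
    · right; right; right; left; exact hP
    · right; right; right; right; right; right; left; exact hP

/-- LOWER BOUNDS AT A NODE for `BR{0,-a,-b,-e}` (`1 ≤ a < b < e ≤ q-1`): the eight `A`-oriented
injected options in top-normalised coordinates. -/
theorem treeBR_quad_node_ge (hq : 1 ≤ q) (A B : SumTree) {a b e : ℕ} (ha : 1 ≤ a) (hab : a < b)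
    (hbe : b < e) (heq : e + 1 ≤ q) :
    let N := treeBR q (.node A B) {0, -(a : ℤ), -(b : ℤ), -(e : ℤ)}
    1 + (treeBR q A {0, -(a : ℤ), -(b : ℤ), -(e : ℤ)} + (2 : ℚ) ^ (-(q : ℤ)) * treeBR q B {0}) ≤ N ∧
    1 + (treeBR q A {0, -(a : ℤ), -(b : ℤ)} + (2 : ℚ) ^ (-(e : ℤ)) * treeBR q B {0, -((q : ℤ) - e)}) ≤ N ∧
    1 + (treeBR q A {0, -(a : ℤ), -(e : ℤ)} + (2 : ℚ) ^ (-(b : ℤ)) * treeBR q B {0, -((q : ℤ) - b)}) ≤ N ∧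
    1 + (treeBR q A {0, -(b : ℤ), -(e : ℤ)} + (2 : ℚ) ^ (-(a : ℤ)) * treeBR q B {0, -((q : ℤ) - a)}) ≤ N ∧
    1 + (treeBR q A {0, -(a : ℤ)} + (2 : ℚ) ^ (-(b : ℤ)) * treeBR q B {0, -((e : ℤ) - b), -((q : ℤ) - b)}) ≤ N ∧
    1 + (treeBR q A {0, -(b : ℤ)} + (2 : ℚ) ^ (-(a : ℤ)) * treeBR q B {0, -((e : ℤ) - a), -((q : ℤ) - a)}) ≤ N ∧
    1 + (treeBR q A {0, -(e : ℤ)} + (2 : ℚ) ^ (-(a : ℤ)) * treeBR q B {0, -((b : ℤ) - a), -((q : ℤ) - a)}) ≤ N ∧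
    1 + (treeBR q A {0} + (2 : ℚ) ^ (-(a : ℤ)) * treeBR q B {0, -((b : ℤ) - a), -((e : ℤ) - a), -((q : ℤ) - a)}) ≤ N := by
  intro N
  classical
  have hT : ∀ z ∈ ({-(a : ℤ), -(b : ℤ), -(e : ℤ)} : Finset ℤ), 1 - (q : ℤ) ≤ z ∧ z ≤ -1 := by
    intro z hz; simp only [Finset.mem_insert, Finset.mem_singleton] at hz; omega
  have key := fun (P : Finset ℤ) (hP : P ⊆ ({-(a : ℤ), -(b : ℤ), -(e : ℤ)} : Finset ℤ)) =>
    injected_le_treeBR_node (q := q) hq A B hT hP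
  have sub : ∀ P : Finset ℤ, (∀ z ∈ P, z = -(a : ℤ) ∨ z = -(b : ℤ) ∨ z = -(e : ℤ)) →
      P ⊆ ({-(a : ℤ), -(b : ℤ), -(e : ℤ)} : Finset ℤ) := by
    intro P h z hz
    simp only [Finset.mem_insert, Finset.mem_singleton]
    exact h z hz
  refine ⟨?_, ?_, ?_, ?_, ?_, ?_, ?_, ?_⟩
  · have h := key {-(a : ℤ), -(b : ℤ), -(e : ℤ)} (fun z hz => hz)
    have e1 : insert (-(q : ℤ)) (({-(a : ℤ), -(b : ℤ), -(e : ℤ)} : Finset ℤ) \ {-(a : ℤ), -(b : ℤ), -(e : ℤ)}) = {-(q : ℤ)} := by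
      rw [Finset.sdiff_self]; rfl
    rw [e1, treeBR_single_shift] at h
    exact h
  · have h := key {-(a : ℤ), -(b : ℤ)} (sub _ (by intro z hz; simp only [Finset.mem_insert, Finset.mem_singleton] at hz; omega))
    have e1 : insert (-(q : ℤ)) (({-(a : ℤ), -(b : ℤ), -(e : ℤ)} : Finset ℤ) \ {-(a : ℤ), -(b : ℤ)}) = {-(e : ℤ), -(q : ℤ)} := by
      ext z; simp only [Finset.mem_insert, Finset.mem_sdiff, Finset.mem_singleton]; omega
    have e2 : treeBR q B {-(e : ℤ), -(q : ℤ)} = (2 : ℚ) ^ (-(e : ℤ)) * treeBR q B {0, -((q : ℤ) - e)} := by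
      rw [← treeBR_pair_shift B (-(e : ℤ)) (-((q : ℤ) - e))]; congr 1; ext z; simp; omega
    have e3 : (insert (0 : ℤ) ({-(a : ℤ), -(b : ℤ)} : Finset ℤ)) = {0, -(a : ℤ), -(b : ℤ)} := rfl
    rw [e1, e2, e3] at h; exact h
  · have h := key {-(a : ℤ), -(e : ℤ)} (sub _ (by intro z hz; simp only [Finset.mem_insert, Finset.mem_singleton] at hz; omega))
    have e1 : insert (-(q : ℤ)) (({-(a : ℤ), -(b : ℤ), -(e : ℤ)} : Finset ℤ) \ {-(a : ℤ), -(e : ℤ)}) = {-(b : ℤ), -(q : ℤ)} := by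
      ext z; simp only [Finset.mem_insert, Finset.mem_sdiff, Finset.mem_singleton]; omega
    have e2 : treeBR q B {-(b : ℤ), -(q : ℤ)} = (2 : ℚ) ^ (-(b : ℤ)) * treeBR q B {0, -((q : ℤ) - b)} := by
      rw [← treeBR_pair_shift B (-(b : ℤ)) (-((q : ℤ) - b))]; congr 1; ext z; simp; omega
    have e3 : (insert (0 : ℤ) ({-(a : ℤ), -(e : ℤ)} : Finset ℤ)) = {0, -(a : ℤ), -(e : ℤ)} := rfl
    rw [e1, e2, e3] at h; exact h
  · have h := key {-(b : ℤ), -(e : ℤ)} (sub _ (by intro z hz; simp only [Finset.mem_insert, Finset.mem_singleton] at hz; omega))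
    have e1 : insert (-(q : ℤ)) (({-(a : ℤ), -(b : ℤ), -(e : ℤ)} : Finset ℤ) \ {-(b : ℤ), -(e : ℤ)}) = {-(a : ℤ), -(q : ℤ)} := by
      ext z; simp only [Finset.mem_insert, Finset.mem_sdiff, Finset.mem_singleton]; omega
    have e2 : treeBR q B {-(a : ℤ), -(q : ℤ)} = (2 : ℚ) ^ (-(a : ℤ)) * treeBR q B {0, -((q : ℤ) - a)} := by
      rw [← treeBR_pair_shift B (-(a : ℤ)) (-((q : ℤ) - a))]; congr 1; ext z; simp; omega
    have e3 : (insert (0 : ℤ) ({-(b : ℤ), -(e : ℤ)} : Finset ℤ)) = {0, -(b : ℤ), -(e : ℤ)} := rfl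
    rw [e1, e2, e3] at h; exact h
  · have h := key {-(a : ℤ)} (sub _ (by intro z hz; simp only [Finset.mem_singleton] at hz; omega))
    have e1 : insert (-(q : ℤ)) (({-(a : ℤ), -(b : ℤ), -(e : ℤ)} : Finset ℤ) \ {-(a : ℤ)}) = {-(b : ℤ), -(e : ℤ), -(q : ℤ)} := by
      ext z; simp only [Finset.mem_insert, Finset.mem_sdiff, Finset.mem_singleton]; omega
    have e2 : treeBR q B {-(b : ℤ), -(e : ℤ), -(q : ℤ)} = (2 : ℚ) ^ (-(b : ℤ)) * treeBR q B {0, -((e : ℤ) - b), -((q : ℤ) - b)} := by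
      rw [← treeBR_triple_shift B (-(b : ℤ)) (-((e : ℤ) - b)) (-((q : ℤ) - b))]; congr 1; ext z; simp; omega
    have e3 : (insert (0 : ℤ) ({-(a : ℤ)} : Finset ℤ)) = {0, -(a : ℤ)} := rfl
    rw [e1, e2, e3] at h; exact h
  · have h := key {-(b : ℤ)} (sub _ (by intro z hz; simp only [Finset.mem_singleton] at hz; omega))
    have e1 : insert (-(q : ℤ)) (({-(a : ℤ), -(b : ℤ), -(e : ℤ)} : Finset ℤ) \ {-(b : ℤ)}) = {-(a : ℤ), -(e : ℤ), -(q : ℤ)} := by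
      ext z; simp only [Finset.mem_insert, Finset.mem_sdiff, Finset.mem_singleton]; omega
    have e2 : treeBR q B {-(a : ℤ), -(e : ℤ), -(q : ℤ)} = (2 : ℚ) ^ (-(a : ℤ)) * treeBR q B {0, -((e : ℤ) - a), -((q : ℤ) - a)} := by
      rw [← treeBR_triple_shift B (-(a : ℤ)) (-((e : ℤ) - a)) (-((q : ℤ) - a))]; congr 1; ext z; simp; omega
    have e3 : (insert (0 : ℤ) ({-(b : ℤ)} : Finset ℤ)) = {0, -(b : ℤ)} := rfl
    rw [e1, e2, e3] at h; exact h
  · have h := key {-(e : ℤ)} (sub _ (by intro z hz; simp only [Finset.mem_singleton] at hz; omega))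
    have e1 : insert (-(q : ℤ)) (({-(a : ℤ), -(b : ℤ), -(e : ℤ)} : Finset ℤ) \ {-(e : ℤ)}) = {-(a : ℤ), -(b : ℤ), -(q : ℤ)} := by
      ext z; simp only [Finset.mem_insert, Finset.mem_sdiff, Finset.mem_singleton]; omega
    have e2 : treeBR q B {-(a : ℤ), -(b : ℤ), -(q : ℤ)} = (2 : ℚ) ^ (-(a : ℤ)) * treeBR q B {0, -((b : ℤ) - a), -((q : ℤ) - a)} := by
      rw [← treeBR_triple_shift B (-(a : ℤ)) (-((b : ℤ) - a)) (-((q : ℤ) - a))]; congr 1; ext z; simp; omega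
    have e3 : (insert (0 : ℤ) ({-(e : ℤ)} : Finset ℤ)) = {0, -(e : ℤ)} := rfl
    rw [e1, e2, e3] at h; exact h
  · have h := key ∅ (Finset.empty_subset _)
    have e1 : insert (-(q : ℤ)) (({-(a : ℤ), -(b : ℤ), -(e : ℤ)} : Finset ℤ) \ ∅) = {-(a : ℤ), -(b : ℤ), -(e : ℤ), -(q : ℤ)} := by
      ext z; simp only [Finset.sdiff_empty, Finset.mem_insert, Finset.mem_singleton]; omega
    have e2 : treeBR q B {-(a : ℤ), -(b : ℤ), -(e : ℤ), -(q : ℤ)} =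
        (2 : ℚ) ^ (-(a : ℤ)) * treeBR q B {0, -((b : ℤ) - a), -((e : ℤ) - a), -((q : ℤ) - a)} := by
      rw [← treeBR_quad_shift B (-(a : ℤ)) (-((b : ℤ) - a)) (-((e : ℤ) - a)) (-((q : ℤ) - a))]; congr 1; ext z; simp; omega
    have e3 : (insert (0 : ℤ) (∅ : Finset ℤ)) = {0} := rfl
    rw [e1, e2, e3] at h; exact h

/-- **THE NODE RULE FOR A FOUR-BIT CONFIGURATION, AS AN UPPER BOUND**: the value of `{0,-a,-b,-e}`
(`1 ≤ a < b < e ≤ q-1`) at a node is `1 +` at most any `R ≥ 0` dominating the sixteen injected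
options (eight subsets, two orientations), in top-normalised coordinates. -/
theorem treeBR_quad_node_le (hq : 1 ≤ q) (A B : SumTree) {a b e : ℕ} (ha : 1 ≤ a) (hab : a < b)
    (hbe : b < e) (heq : e + 1 ≤ q) {R : ℚ} (hR : 0 ≤ R)
    (h : ∀ X Y : SumTree, (X = A ∧ Y = B) ∨ (X = B ∧ Y = A) →
      treeBR q X {0, -(a : ℤ), -(b : ℤ), -(e : ℤ)} + (2 : ℚ) ^ (-(q : ℤ)) * treeBR q Y {0} ≤ R ∧
      treeBR q X {0, -(a : ℤ), -(b : ℤ)} + (2 : ℚ) ^ (-(e : ℤ)) * treeBR q Y {0, -((q : ℤ) - e)} ≤ R ∧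
      treeBR q X {0, -(a : ℤ), -(e : ℤ)} + (2 : ℚ) ^ (-(b : ℤ)) * treeBR q Y {0, -((q : ℤ) - b)} ≤ R ∧
      treeBR q X {0, -(b : ℤ), -(e : ℤ)} + (2 : ℚ) ^ (-(a : ℤ)) * treeBR q Y {0, -((q : ℤ) - a)} ≤ R ∧
      treeBR q X {0, -(a : ℤ)} + (2 : ℚ) ^ (-(b : ℤ)) * treeBR q Y {0, -((e : ℤ) - b), -((q : ℤ) - b)} ≤ R ∧
      treeBR q X {0, -(b : ℤ)} + (2 : ℚ) ^ (-(a : ℤ)) * treeBR q Y {0, -((e : ℤ) - a), -((q : ℤ) - a)} ≤ R ∧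
      treeBR q X {0, -(e : ℤ)} + (2 : ℚ) ^ (-(a : ℤ)) * treeBR q Y {0, -((b : ℤ) - a), -((q : ℤ) - a)} ≤ R ∧
      treeBR q X {0} + (2 : ℚ) ^ (-(a : ℤ)) * treeBR q Y {0, -((b : ℤ) - a), -((e : ℤ) - a), -((q : ℤ) - a)} ≤ R) :
    treeBR q (.node A B) {0, -(a : ℤ), -(b : ℤ), -(e : ℤ)} ≤ 1 + R := by
  classical
  have hT : ∀ z ∈ ({-(a : ℤ), -(b : ℤ), -(e : ℤ)} : Finset ℤ), 1 - (q : ℤ) ≤ z ∧ z ≤ -1 := by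
    intro z hz; simp only [Finset.mem_insert, Finset.mem_singleton] at hz; omega
  have eS : ({0, -(a : ℤ), -(b : ℤ), -(e : ℤ)} : Finset ℤ) = insert 0 {-(a : ℤ), -(b : ℤ), -(e : ℤ)} := rfl
  rw [eS]
  refine treeBR_node_le_of_injected hq A B hT hR fun P hP => ?_
  obtain ⟨hAB1, hAB2, hAB3, hAB4, hAB5, hAB6, hAB7, hAB8⟩ := h A B (Or.inl ⟨rfl, rfl⟩)
  obtain ⟨hBA1, hBA2, hBA3, hBA4, hBA5, hBA6, hBA7, hBA8⟩ := h B A (Or.inr ⟨rfl, rfl⟩)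
  -- shifts of the complements
  have sq : ∀ Y : SumTree, treeBR q Y {-(q : ℤ)} = (2 : ℚ) ^ (-(q : ℤ)) * treeBR q Y {0} := fun Y => by
    rw [treeBR_single_shift]
  have se : ∀ Y : SumTree, treeBR q Y {-(e : ℤ), -(q : ℤ)} = (2 : ℚ) ^ (-(e : ℤ)) * treeBR q Y {0, -((q : ℤ) - e)} := fun Y => by
    rw [← treeBR_pair_shift Y (-(e : ℤ)) (-((q : ℤ) - e))]; congr 1; ext z; simp; omega
  have sb : ∀ Y : SumTree, treeBR q Y {-(b : ℤ), -(q : ℤ)} = (2 : ℚ) ^ (-(b : ℤ)) * treeBR q Y {0, -((q : ℤ) - b)} := fun Y => by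
    rw [← treeBR_pair_shift Y (-(b : ℤ)) (-((q : ℤ) - b))]; congr 1; ext z; simp; omega
  have sa : ∀ Y : SumTree, treeBR q Y {-(a : ℤ), -(q : ℤ)} = (2 : ℚ) ^ (-(a : ℤ)) * treeBR q Y {0, -((q : ℤ) - a)} := fun Y => by
    rw [← treeBR_pair_shift Y (-(a : ℤ)) (-((q : ℤ) - a))]; congr 1; ext z; simp; omega
  have sbe : ∀ Y : SumTree, treeBR q Y {-(b : ℤ), -(e : ℤ), -(q : ℤ)} =
      (2 : ℚ) ^ (-(b : ℤ)) * treeBR q Y {0, -((e : ℤ) - b), -((q : ℤ) - b)} := fun Y => by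
    rw [← treeBR_triple_shift Y (-(b : ℤ)) (-((e : ℤ) - b)) (-((q : ℤ) - b))]; congr 1; ext z; simp; omega
  have sae : ∀ Y : SumTree, treeBR q Y {-(a : ℤ), -(e : ℤ), -(q : ℤ)} =
      (2 : ℚ) ^ (-(a : ℤ)) * treeBR q Y {0, -((e : ℤ) - a), -((q : ℤ) - a)} := fun Y => by
    rw [← treeBR_triple_shift Y (-(a : ℤ)) (-((e : ℤ) - a)) (-((q : ℤ) - a))]; congr 1; ext z; simp; omega
  have sab : ∀ Y : SumTree, treeBR q Y {-(a : ℤ), -(b : ℤ), -(q : ℤ)} =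
      (2 : ℚ) ^ (-(a : ℤ)) * treeBR q Y {0, -((b : ℤ) - a), -((q : ℤ) - a)} := fun Y => by
    rw [← treeBR_triple_shift Y (-(a : ℤ)) (-((b : ℤ) - a)) (-((q : ℤ) - a))]; congr 1; ext z; simp; omega
  have sabe : ∀ Y : SumTree, treeBR q Y {-(a : ℤ), -(b : ℤ), -(e : ℤ), -(q : ℤ)} =
      (2 : ℚ) ^ (-(a : ℤ)) * treeBR q Y {0, -((b : ℤ) - a), -((e : ℤ) - a), -((q : ℤ) - a)} := fun Y => by
    rw [← treeBR_quad_shift Y (-(a : ℤ)) (-((b : ℤ) - a)) (-((e : ℤ) - a)) (-((q : ℤ) - a))]; congr 1; ext z; simp; omega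
  -- the eight cases
  rcases subset_three_cases hP with hP0 | hP0 | hP0 | hP0 | hP0 | hP0 | hP0 | hP0 <;> subst hP0
  · have e1 : insert (-(q : ℤ)) (({-(a : ℤ), -(b : ℤ), -(e : ℤ)} : Finset ℤ) \ ∅) = {-(a : ℤ), -(b : ℤ), -(e : ℤ), -(q : ℤ)} := by
      ext z; simp only [Finset.sdiff_empty, Finset.mem_insert, Finset.mem_singleton]; omega
    have e2 : (insert (0 : ℤ) (∅ : Finset ℤ)) = {0} := rfl
    rw [e1, e2, sabe, sabe]; exact ⟨hAB8, hBA8⟩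
  · have e1 : insert (-(q : ℤ)) (({-(a : ℤ), -(b : ℤ), -(e : ℤ)} : Finset ℤ) \ {-(a : ℤ)}) = {-(b : ℤ), -(e : ℤ), -(q : ℤ)} := by
      ext z; simp only [Finset.mem_insert, Finset.mem_sdiff, Finset.mem_singleton]; omega
    have e2 : (insert (0 : ℤ) ({-(a : ℤ)} : Finset ℤ)) = {0, -(a : ℤ)} := rfl
    rw [e1, e2, sbe, sbe]; exact ⟨hAB5, hBA5⟩
  · have e1 : insert (-(q : ℤ)) (({-(a : ℤ), -(b : ℤ), -(e : ℤ)} : Finset ℤ) \ {-(b : ℤ)}) = {-(a : ℤ), -(e : ℤ), -(q : ℤ)} := by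
      ext z; simp only [Finset.mem_insert, Finset.mem_sdiff, Finset.mem_singleton]; omega
    have e2 : (insert (0 : ℤ) ({-(b : ℤ)} : Finset ℤ)) = {0, -(b : ℤ)} := rfl
    rw [e1, e2, sae, sae]; exact ⟨hAB6, hBA6⟩
  · have e1 : insert (-(q : ℤ)) (({-(a : ℤ), -(b : ℤ), -(e : ℤ)} : Finset ℤ) \ {-(e : ℤ)}) = {-(a : ℤ), -(b : ℤ), -(q : ℤ)} := by
      ext z; simp only [Finset.mem_insert, Finset.mem_sdiff, Finset.mem_singleton]; omega
    have e2 : (insert (0 : ℤ) ({-(e : ℤ)} : Finset ℤ)) = {0, -(e : ℤ)} := rfl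
    rw [e1, e2, sab, sab]; exact ⟨hAB7, hBA7⟩
  · have e1 : insert (-(q : ℤ)) (({-(a : ℤ), -(b : ℤ), -(e : ℤ)} : Finset ℤ) \ {-(a : ℤ), -(b : ℤ)}) = {-(e : ℤ), -(q : ℤ)} := by
      ext z; simp only [Finset.mem_insert, Finset.mem_sdiff, Finset.mem_singleton]; omega
    have e2 : (insert (0 : ℤ) ({-(a : ℤ), -(b : ℤ)} : Finset ℤ)) = {0, -(a : ℤ), -(b : ℤ)} := rfl
    rw [e1, e2, se, se]; exact ⟨hAB2, hBA2⟩
  · have e1 : insert (-(q : ℤ)) (({-(a : ℤ), -(b : ℤ), -(e : ℤ)} : Finset ℤ) \ {-(a : ℤ), -(e : ℤ)}) = {-(b : ℤ), -(q : ℤ)} := by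
      ext z; simp only [Finset.mem_insert, Finset.mem_sdiff, Finset.mem_singleton]; omega
    have e2 : (insert (0 : ℤ) ({-(a : ℤ), -(e : ℤ)} : Finset ℤ)) = {0, -(a : ℤ), -(e : ℤ)} := rfl
    rw [e1, e2, sb, sb]; exact ⟨hAB3, hBA3⟩
  · have e1 : insert (-(q : ℤ)) (({-(a : ℤ), -(b : ℤ), -(e : ℤ)} : Finset ℤ) \ {-(b : ℤ), -(e : ℤ)}) = {-(a : ℤ), -(q : ℤ)} := by
      ext z; simp only [Finset.mem_insert, Finset.mem_sdiff, Finset.mem_singleton]; omega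
    have e2 : (insert (0 : ℤ) ({-(b : ℤ), -(e : ℤ)} : Finset ℤ)) = {0, -(b : ℤ), -(e : ℤ)} := rfl
    rw [e1, e2, sa, sa]; exact ⟨hAB4, hBA4⟩
  · have e1 : insert (-(q : ℤ)) (({-(a : ℤ), -(b : ℤ), -(e : ℤ)} : Finset ℤ) \ {-(a : ℤ), -(b : ℤ), -(e : ℤ)}) = {-(q : ℤ)} := by
      rw [Finset.sdiff_self]; rfl
    have e2 : (insert (0 : ℤ) ({-(a : ℤ), -(b : ℤ), -(e : ℤ)} : Finset ℤ)) = {0, -(a : ℤ), -(b : ℤ), -(e : ℤ)} := rfl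
    rw [e1, e2, sq, sq]; exact ⟨hAB1, hBA1⟩

/-- (MC) for `{0,-a,-b,-i}` (`1 ≤ a < b`, `b + 2 ≤ i ≤ q-1`) in the direction of the bit `-i` (no run):
`2 BR{0,-a,-b,-i} ≤ BR{0,-a,-b,-(i-1)} + BR{0,-a,-b}`. -/
theorem two_treeBR_quad_le (t : SumTree) {a b i : ℕ} (ha : 1 ≤ a) (hab : a < b) (hbi : b + 2 ≤ i) (hiq : i + 1 ≤ q) :
    2 * treeBR q t {0, -(a : ℤ), -(b : ℤ), -(i : ℤ)} ≤
      treeBR q t {0, -(a : ℤ), -(b : ℤ), -((i : ℤ) - 1)} + treeBR q t {0, -(a : ℤ), -(b : ℤ)} := by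
  classical
  have hS : Routable q ({0, -(a : ℤ), -(b : ℤ), -(i : ℤ)} : Finset ℤ) := by
    intro x hx y hy
    simp only [Finset.mem_insert, Finset.mem_singleton] at hx hy
    rcases hx with rfl | rfl | rfl | rfl <;> rcases hy with rfl | rfl | rfl | rfl <;> omega
  have hS' : Routable q ({0, -(a : ℤ), -(b : ℤ), -((i : ℤ) - 1)} : Finset ℤ) := by
    intro x hx y hy
    simp only [Finset.mem_insert, Finset.mem_singleton] at hx hy
    rcases hx with rfl | rfl | rfl | rfl <;> rcases hy with rfl | rfl | rfl | rfl <;> omega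
  have hrun : ∀ n : ℕ, n ≤ 0 → -(i : ℤ) + (n : ℤ) ∈ ({0, -(a : ℤ), -(b : ℤ), -(i : ℤ)} : Finset ℤ) := by
    intro n hn
    have : n = 0 := by omega
    subst this; simp
  have hβ' : -(i : ℤ) + (((0 : ℕ) : ℤ) + 1) ∉ ({0, -(a : ℤ), -(b : ℤ), -(i : ℤ)} : Finset ℤ) := by
    simp only [Nat.cast_zero, zero_add, Finset.mem_insert, Finset.mem_singleton]; omega
  have e1 : insert (-(i : ℤ) + (((0 : ℕ) : ℤ) + 1))
      (({0, -(a : ℤ), -(b : ℤ), -(i : ℤ)} : Finset ℤ) \ (Finset.range (0 + 1)).image (fun n : ℕ => -(i : ℤ) + (n : ℤ))) =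
        ({0, -(a : ℤ), -(b : ℤ), -((i : ℤ) - 1)} : Finset ℤ) := by
    ext z
    simp only [Nat.cast_zero, zero_add, Finset.range_one, Finset.image_singleton, add_zero,
      Finset.mem_insert, Finset.mem_sdiff, Finset.mem_singleton]
    omega
  have e2 : ({0, -(a : ℤ), -(b : ℤ), -(i : ℤ)} : Finset ℤ).erase (-(i : ℤ)) = {0, -(a : ℤ), -(b : ℤ)} := by
    ext z
    simp only [Finset.mem_erase, Finset.mem_insert, Finset.mem_singleton]
    omega
  have hmc := treeBR_midconvex (q := q) t hS (β := -(i : ℤ)) (j := 0) hrun hβ' (by rw [e1]; exact hS')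
  rw [e1, e2] at hmc
  exact hmc

end QuadNode

end Summit.Ventures.CertifiedArithmetic.LowPrec.Opt
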